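import Summits.FinalStateConjecture.FinalStateConjecture.Theorems.KerrShieldedDataExist.Negative.BentSliceConormal
import Literature.Analysis.Calculus.SmoothConvexCutoff
import Literature.Analysis.Calculus.SmoothCutoff
import Mathlib.Analysis.SpecialFunctions.SmoothTransition
import Mathlib.Analysis.Calculus.Deriv.MeanValue
import HarnessLib

/-!
# `KerrShieldedDataExist`, line `plug-the-second-sheet` — the bridge annulus, IV: the radial spacelike
# criterion zone by zone, and the rounded corner

Support file (everything proved) for stub `stub_bridgeAnnulus` of crux `stmt-FinalStateConjecture-10055`.
A radial immersion `y ↦ (τ(s), (ϱ(s)/s) y)` into the Schwarzschild Kerr–Schild chart is spacelike iff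
`A = −τ′² + ϱ′² + (2M/ϱ)(τ′ + ϱ′)² > 0` (`…BridgeRadial`); in the `(t*, r)` half-plane this is the cone condition
`(ṫ + ṙ)((2M − r)ṫ + (2M + r)ṙ) > 0` of the Kerr–Schild form (Dafermos–Rodnianski arXiv:0811.0354, §5.1). We
record it for the four model pieces of the bridge:

* `radialA_pos_of_slice` (a Kerr–Schild slice `{t* = c}` traversed radially), `radialA_pos_of_graph` (a graph
  `t* = h(r)`, through the conormal form `Negative.conormalForm` of the disprover's certificate),
  `radialA_pos_of_corner` (a curve with `t* + r` decreasing at unit rate and radial slope `≤ 1/2`, inside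
  `{r < M}`), `radialA_pos_of_steep` + `steep_of_convex_combination` (graphs inside the horizon steeper than the
  ingoing null slope `−(2M + r)/(2M − r)`: the segment `t* = 3(M − r)` and `t* = 4M log(1 − r/2M)`);
* `exists_cornerRadius` — the radius profile of the ROUNDED CORNER: a `C^∞` function equal to `ℓ₀ − s` for
  `s ≤ 9M/20` and to `9M/40 + s/2` for `s ≥ M/2`, with slope `≤ 1/2`, built as a smooth maximum with the smooth
  convex cut-off of `Literature.Analysis.Calculus.exists_smooth_convex_cutoff` (Gursky–LeBrun 1999).
-/

-- the doubled `FinalStateConjecture` path component is the summit/problem naming scheme, not a mistake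
set_option linter.dupNamespace false

noncomputable section

open Real Set Filter
open scoped Manifold ContDiff Topology InnerProductSpace
open Literature.Geometry.Lorentzian
open Summit.FinalStateConjecture.FinalStateConjecture.Theorems.KerrShieldedDataExist

namespace Summit.FinalStateConjecture.FinalStateConjecture.Theorems.SwallowTheDatum

namespace Bridge

/-! ### The radial spacelike criterion `A = −τ′² + ϱ′² + (2M/ϱ)(τ′ + ϱ′)² > 0`, zone by zone -/

section Zones

variable {M ϱ ϱ₁ t₁ : ℝ}

/-- On a Kerr–Schild slice `{t* = const}` traversed radially (`τ′ = 0`, `ϱ′ ≠ 0`), `A = ϱ′²(1 + 2M/ϱ) > 0`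
(`M ≥ 0`, `ϱ > 0`). [cite: Cook2000, §3.2.2 (55)] -/
theorem radialA_pos_of_slice (hM : 0 ≤ M) (hϱ : 0 < ϱ) (hϱ₁ : ϱ₁ ≠ 0) :
    0 < -(0 : ℝ) ^ 2 + ϱ₁ ^ 2 + 2 * M / ϱ * (0 + ϱ₁) ^ 2 := by
  have h1 : 0 < ϱ₁ ^ 2 := by positivity
  have h2 : 0 ≤ 2 * M / ϱ * (0 + ϱ₁) ^ 2 := by positivity
  linarith

/-- For a graph `t* = h(r)` read through a radial reparametrisation (`τ′ = h′(ϱ) ϱ′`, `ϱ′ ≠ 0`),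
`A = ϱ′² · (−Q)/ϱ²` with `Q = −ϱ² + h′²ϱ² − 2Mϱ(1 + h′)²` the conormal form of the graph
(`Negative.conormalForm M 0 ϱ c h′`), so `A > 0` as soon as `Q < 0`. [cite: arXiv08110354, §5.1] -/
theorem radialA_pos_of_graph {p c : ℝ} (hϱ : 0 < ϱ) (hϱ₁ : ϱ₁ ≠ 0)
    (hQ : Negative.conormalForm M 0 ϱ c p < 0) :
    0 < -(p * ϱ₁) ^ 2 + ϱ₁ ^ 2 + 2 * M / ϱ * (p * ϱ₁ + ϱ₁) ^ 2 := by
  have key : -(p * ϱ₁) ^ 2 + ϱ₁ ^ 2 + 2 * M / ϱ * (p * ϱ₁ + ϱ₁) ^ 2 =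
      ϱ₁ ^ 2 / ϱ ^ 2 * (-Negative.conormalForm M 0 ϱ c p) := by
    unfold Negative.conormalForm
    field_simp
    ring
  rw [key]
  exact mul_pos (by positivity) (neg_pos.2 hQ)

/-- **The rounded corner is spacelike.** Along a curve with `t* + r` decreasing at unit rate
(`τ′ = −1 − ϱ′`) whose radial slope satisfies `ϱ′ ≤ 1/2`, inside `{ϱ < M}`:
`A = (2M/ϱ − 1) − 2ϱ′ > 0`. [folklore] -/
theorem radialA_pos_of_corner (hϱ : 0 < ϱ) (hϱM : ϱ < M) (hϱ₁ : ϱ₁ ≤ 1 / 2)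
    (ht₁ : t₁ = -1 - ϱ₁) :
    0 < -t₁ ^ 2 + ϱ₁ ^ 2 + 2 * M / ϱ * (t₁ + ϱ₁) ^ 2 := by
  have key : -t₁ ^ 2 + ϱ₁ ^ 2 + 2 * M / ϱ * (t₁ + ϱ₁) ^ 2 = (2 * M / ϱ - 1) - 2 * ϱ₁ := by
    rw [ht₁]; ring
  rw [key]
  have h2 : 2 < 2 * M / ϱ := by
    rw [lt_div_iff₀ hϱ]; linarith
  linarith

/-- **The ascending branch is spacelike.** For a graph `t* = g(r)` inside the horizon traversed with
`ϱ′ > 0` (`τ′ = p ϱ′`, `p = g′(ϱ)`), `A = (ϱ′²/ϱ)(p + 1)((2M − ϱ)p + (2M + ϱ))`, which is positive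
when `(2M − ϱ) p + (2M + ϱ) < 0` (then also `p + 1 < 0`): the slope lies below the ingoing null slope
`−(2M + ϱ)/(2M − ϱ)` (Dafermos–Rodnianski arXiv:0811.0354, §5.1: the cone of the Kerr–Schild form).
[cite: arXiv08110354, §5.1] -/
theorem radialA_pos_of_steep {p : ℝ} (hϱ : 0 < ϱ) (hϱ2 : ϱ < 2 * M) (hϱ₁ : 0 < ϱ₁)
    (hp : (2 * M - ϱ) * p + (2 * M + ϱ) < 0) :
    0 < -(p * ϱ₁) ^ 2 + ϱ₁ ^ 2 + 2 * M / ϱ * (p * ϱ₁ + ϱ₁) ^ 2 := by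
  have key : -(p * ϱ₁) ^ 2 + ϱ₁ ^ 2 + 2 * M / ϱ * (p * ϱ₁ + ϱ₁) ^ 2 =
      ϱ₁ ^ 2 / ϱ * ((p + 1) * ((2 * M - ϱ) * p + (2 * M + ϱ))) := by
    field_simp
    ring
  rw [key]
  have h1 : p + 1 < 0 := by nlinarith
  exact mul_pos (by positivity) (mul_pos_of_neg_of_neg h1 hp)

/-- The two model slopes of the ascending branch are steep enough: the straight segment `t* = 3(M − r)`
(`p = −3`) for `ϱ < M`, and the Kerr–Schild graph `t* = 4M log(1 − r/2M)` (`p = −4M/(2M − ϱ)`) for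
`ϱ < 2M`; hence so is every convex combination of them (`ϱ < M`). [cite: arXiv08110354, §5.1] -/
theorem steep_of_convex_combination {μ : ℝ} (hμ0 : 0 ≤ μ) (hμ1 : μ ≤ 1) (hϱ : 0 < ϱ) (hϱM : ϱ < M) :
    (2 * M - ϱ) * ((1 - μ) * (-3) + μ * (-(4 * M) / (2 * M - ϱ))) + (2 * M + ϱ) < 0 := by
  have h2 : 0 < 2 * M - ϱ := by linarith
  have key : (2 * M - ϱ) * ((1 - μ) * (-3) + μ * (-(4 * M) / (2 * M - ϱ))) + (2 * M + ϱ) =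
      (1 - μ) * (-3 * (2 * M - ϱ) + (2 * M + ϱ)) + μ * (-(4 * M) + (2 * M + ϱ)) := by
    field_simp
    ring
  rw [key]
  have hA : -3 * (2 * M - ϱ) + (2 * M + ϱ) < 0 := by linarith
  have hB : -(4 * M) + (2 * M + ϱ) < 0 := by linarith
  rcases eq_or_lt_of_le hμ0 with h | h
  · rw [← h]; linarith
  · nlinarith

end Zones

/-! ### The rounded corner: a smooth radius profile with slope in `[−1, 1/2]` -/

section Corner

variable {M : ℝ}

/-- **The corner radius profile.** There are a `C^∞` function `ϱc` and a constant `ℓ₀ ∈ [9M/10, 21M/20)`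
with `ϱc(s) = ℓ₀ − s` for `s ≤ 9M/20` (descending Kerr–Schild slice of the left chart), `ϱc(s) = 9M/40 + s/2`
for `s ≥ M/2` (ascending straight segment `t* = 3(M − r)` read over `v = t* + r`), slope `ϱc′ ≤ 1/2`
everywhere, and `9M/40 + s/2 ≤ ϱc(s) < max(21M/20 − s, 9M/40 + s/2 + 3M/20)`: the smooth maximum
`f₂ + f_ε(f₁ − f₂) − f_ε(0)` of the two branches `f₁ = 21M/20 − s`, `f₂ = 9M/40 + s/2` built with the smooth
convex cut-off `f_ε` of `exists_smooth_convex_cutoff` (`ε = 3M/20`; `0 ≤ f_ε′ ≤ 1` makes `ϱc′` a convex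
combination of `−1` and `1/2`). [cite: GurskyLebrun1999, §3, proof of Lemma 4] -/
theorem exists_cornerRadius (hM : 0 < M) :
    ∃ (ϱc : ℝ → ℝ) (ℓ₀ : ℝ), ContDiff ℝ ∞ ϱc ∧ 9 * M / 10 ≤ ℓ₀ ∧ ℓ₀ < 21 * M / 20 ∧
      (∀ s, s ≤ 9 * M / 20 → ϱc s = ℓ₀ - s) ∧ (∀ s, M / 2 ≤ s → ϱc s = 9 * M / 40 + s / 2) ∧
      (∀ s, HasDerivAt ϱc (deriv ϱc s) s ∧ deriv ϱc s ≤ 1 / 2) ∧ (∀ s, 9 * M / 40 + s / 2 ≤ ϱc s) ∧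
      (∀ s, ϱc s < max (21 * M / 20 - s) (9 * M / 40 + s / 2 + 3 * M / 20)) := by
  obtain ⟨f, hfs, hfpos, hfconst, hfid, hfder, -, hfle, -⟩ :=
    Literature.Analysis.Calculus.exists_smooth_convex_cutoff (ε := 3 * M / 20) (by positivity)
  have hfd : Differentiable ℝ f := hfs.differentiable (by simp)
  have hfmono : Monotone f := monotone_of_deriv_nonneg hfd fun x ↦ (hfder x).1
  -- the argument `u(s) = f₁ − f₂ = 33M/40 − 3s/2`
  have hu : ∀ s, HasDerivAt (fun s : ℝ ↦ 33 * M / 40 - 3 / 2 * s) (-(3 / 2)) s := fun s ↦ by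
    simpa using ((hasDerivAt_id s).const_mul (3 / 2 : ℝ)).const_sub (33 * M / 40)
  refine ⟨fun s ↦ 9 * M / 40 + s / 2 + (f (33 * M / 40 - 3 / 2 * s) - f 0), 21 * M / 20 - f 0, ?_, ?_, ?_,
    ?_, ?_, ?_, ?_, ?_⟩
  · exact (contDiff_const.add (contDiff_id.div_const _)).add
      ((hfs.comp (contDiff_const.sub (contDiff_const.mul contDiff_id))).sub contDiff_const)
  · have := hfle 0 (by positivity); linarith
  · have := hfpos 0; linarith
  · intro s hs
    have h : 3 * M / 20 ≤ 33 * M / 40 - 3 / 2 * s := by linarith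
    simp only [hfid _ h]; ring
  · intro s hs
    have h : 33 * M / 40 - 3 / 2 * s ≤ 3 * M / 20 / 2 := by linarith
    simp only [hfconst _ h]; ring
  · intro s
    have hd : HasDerivAt (fun s : ℝ ↦ 9 * M / 40 + s / 2 + (f (33 * M / 40 - 3 / 2 * s) - f 0))
        (1 / 2 + deriv f (33 * M / 40 - 3 / 2 * s) * (-(3 / 2))) s := by
      have h1 : HasDerivAt (fun s : ℝ ↦ 9 * M / 40 + s / 2) (1 / 2) s := by
        simpa using ((hasDerivAt_id s).div_const (2 : ℝ)).const_add (9 * M / 40)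
      have h2 := ((hfd _).hasDerivAt.comp s (hu s)).sub_const (f 0)
      exact h1.add h2
    refine ⟨hd.deriv ▸ hd, ?_⟩
    rw [hd.deriv]
    have := (hfder (33 * M / 40 - 3 / 2 * s)).1
    nlinarith
  · intro s
    have h : f 0 ≤ f (33 * M / 40 - 3 / 2 * s) := by
      rcases le_or_gt (33 * M / 40 - 3 / 2 * s) (3 * M / 20 / 2) with h | h
      · rw [hfconst _ h]
      · have h0 : (0 : ℝ) < 3 * M / 20 / 2 := by positivity
        exact hfmono (by linarith)
    show 9 * M / 40 + s / 2 ≤ 9 * M / 40 + s / 2 + (f (33 * M / 40 - 3 / 2 * s) - f 0)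
    linarith
  · intro s
    have h0 := hfpos 0
    show 9 * M / 40 + s / 2 + (f (33 * M / 40 - 3 / 2 * s) - f 0) < _
    rcases le_or_gt (33 * M / 40 - 3 / 2 * s) (3 * M / 20) with h | h
    · have := hfle _ h
      have : 9 * M / 40 + s / 2 + (f (33 * M / 40 - 3 / 2 * s) - f 0) < 9 * M / 40 + s / 2 + 3 * M / 20 := by
        linarith
      exact this.trans_le (le_max_right _ _)
    · rw [hfid _ h.le]
      have : 9 * M / 40 + s / 2 + (33 * M / 40 - 3 / 2 * s - f 0) < 21 * M / 20 - s := by linarith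
      exact this.trans_le (le_max_left _ _)

end Corner

end Bridge

/-- **Registered export of this file** (sub-goal `bridge_cornerRadius` of stub `stub_bridgeAnnulus`): the rounded-corner radius profile, `Bridge.exists_cornerRadius`. [cite: GurskyLebrun1999, §3, proof of Lemma 4] -/
theorem bridge_cornerRadius :
    ∀ (M : ℝ), 0 < M → ∃ (ϱc : ℝ → ℝ) (ℓ₀ : ℝ), ContDiff ℝ ∞ ϱc ∧ 9 * M / 10 ≤ ℓ₀ ∧ ℓ₀ < 21 * M / 20 ∧ (∀ s, s ≤ 9 * M / 20 → ϱc s = ℓ₀ - s) ∧ (∀ s, M / 2 ≤ s → ϱc s = 9 * M / 40 + s / 2) ∧ (∀ s, HasDerivAt ϱc (deriv ϱc s) s ∧ deriv ϱc s ≤ 1 / 2) ∧ (∀ s, 9 * M / 40 + s / 2 ≤ ϱc s) ∧ (∀ s, ϱc s < max (21 * M / 20 - s) (9 * M / 40 + s / 2 + 3 * M / 20)) :=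
  fun _ hM ↦ Bridge.exists_cornerRadius hM

end Summit.FinalStateConjecture.FinalStateConjecture.Theorems.SwallowTheDatum

end
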